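import Summits.CriticalPhenomena.SAWScalingLimit.Theorems.SAWDevelopingMapObservableToSLERestrictionIdentifiesSandwich
import Summits.CriticalPhenomena.SAWScalingLimit.Theorems.SAWDevelopingMapObservableToSLERestrictionIdentifiesHulls
import Literature.Probability.RandomPlanarGeometry.HullRestrictionSLEHolds
import Literature.Probability.RandomPlanarGeometry.CaratheodoryHalfPlaneProofs

/-!
# Crux `SAWDevelopingMap.ObservableToSLE` (stmt-CriticalPhenomena-10472), line
`floor-ratio-restriction-bootstrap`, stub `stub_restrictionIdentifies`: SLE(8/3) side and the squeeze

Landing target: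
`Summits/CriticalPhenomena/SAWScalingLimit/Theorems/SAWDevelopingMapObservableToSLERestrictionIdentifiesTransfer.lean`
(`--supports stmt-CriticalPhenomena-10472`).

Two measure-theoretic steps of the LSW closing `stub_restrictionIdentifies` (assembled in the sibling
file `…RestrictionIdentifies`):

* `stub_restrictionIdentifies_sleLaw` (registered sub-goal; named-binder form
  `exists_sleLaw_through`) — **the chordal SLE(8/3) law of `(D; a, b)` through a chordal uniformizing
  map `φ`**: a probability law on curve classes, an `IsSLELaw (8/3) D`, carried by the chordal
  carrier, whose probability of avoiding `φ̂(A)` is `Φ'_A(0)^{5/8}` for every `*`-hull `A` ([LSW]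
  Thm. 6.1 in the half-plane, `sle_restriction_eightThirds_holds`, read through the compactified
  image of the trace; Rohde–Schramm for simplicity and transience of the SLE(8/3) trace);
* `measure_avoid_eq_of_squeeze` — **identification of the avoidance probability of a squeezed
  `*`-hull**: if `μ` satisfies the hypotheses of `stub_restrictionIdentifies` and the `*`-hull `B` is
  squeezed by the pull-backs `A_k ↓` of Jordan hull subdomains `D_k` (`B ∩ ℍ ⊆ int A_k`,
  `(⋂ A_k) ∩ ℍ ⊆ B`), then `μ{trace ∩ φ̂(B) = ∅} = ν{trace ∩ φ̂(B) = ∅}` for the SLE law `ν`: for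
  EVERY law carried by the chordal carrier the avoidance probability of `B` is the supremum of those
  of the `A_k` (outer continuity of avoidance, `measure_avoid_eq_iSup_of_squeeze`); for `ν` these are
  `d_k^{5/8}`; for `μ` the portmanteau sandwich (`sandwich`) gives
  `μ{avoid A_k} ≤ d_k^{5/8} ≤ μ{curve ⊆ cl D_k} ≤ μ{avoid B}`, whence
  `μ{avoid B} = supₖ d_k^{5/8} = ν{avoid B}` — no continuity of `A ↦ Φ'_A(0)` is needed.
-/
noncomputable section

open scoped BigOperators Topology NNReal ENNReal Classical
open Filter Set MeasureTheory Metric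
open Literature.Probability.LatticeModels (HexVertex hexGraph hexCenter)
open Literature.Probability.RandomPlanarGeometry
open Literature.Probability.RandomPlanarGeometry.SAW
open UpperHalfPlane (upperHalfPlaneSet isOpen_upperHalfPlaneSet)

namespace Summit.CriticalPhenomena.SAWScalingLimit.Theorems.ObservableToSLE.FloorRatio

open Summit.CriticalPhenomena.SAWScalingLimit.Theorems.ObservableToSLE.Negative
  (eventually_isProbabilityMeasure_hexSAWLaw)

/-! ### The SLE(8/3) law through a uniformizing map and its hull-avoidance probabilities -/

/-- **The chordal SLE(8/3) law of `(D; a, b)` through the uniformizing map `φ`**: a probability law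
carried by the chordal carrier whose avoidance probability of `φ̂(A)` is `Φ'_A(0)^{5/8}` for every
`*`-hull `A` ([LSW] Thm. 6.1 in the half-plane, `sle_restriction_eightThirds_holds`, read through the
compactified image of the trace; Rohde–Schramm for simplicity and transience of the trace).
[cite: LawlerSchrammWerner2003Restriction, Thm. 6.1 (p. 23)] -/
theorem exists_sleLaw_through {D : DobrushinDomain} {φ : ConformalEquiv upperHalfPlaneSet D.carrier}
    (hφ : D.IsChordalUniformizing φ) :
    ∃ ν : Measure (CurveClass ℂ), IsSLELaw ((8 : ℝ≥0) / 3) D ν ∧ IsProbabilityMeasure ν ∧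
      (∀ᵐ c ∂ν, c ∈ chordalCarrier D) ∧
      ∀ (A : Set ℂ) (Φ : ConformalEquiv (upperHalfPlaneSet \ A) upperHalfPlaneSet) (d : ℝ),
        IsStarHull A → IsRestrictionMap A Φ → HasRestrictionDeriv A Φ d →
        ν (CurveClass.rangeSubset (φ.boundaryExtension '' A)ᶜ) = ENNReal.ofReal (d ^ ((5 : ℝ) / 8)) := by
  classical
  have hκt : HasSLETrace ((8 : ℝ≥0) / 3) := hasSLETrace_eightThirds
  have h61 : sle_restriction_eightThirds := sle_restriction_eightThirds_holds
  have hC : JordanDomain.exists_continuousOn_extension := JordanDomain.exists_continuousOn_extension_holds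
  have h₆ : Literature.Probability.RandomPlanarGeometry.ae_isSimpleTrace_sleTrace_of_le_four
      (κ := (8 : ℝ≥0) / 3) :=
    fun _ h4 ↦ ae_isSimpleTrace_sleTrace_of_hasSLETrace hκt h4
  have htr := tendsto_norm_sleTrace_atTop_eightThirds_of_hasSLETrace hκt
  have hmeas : aemeasurable_sleTrace := aemeasurable_sleTrace_holds
  have hκ0 : (0 : ℝ≥0) < 8 / 3 := by positivity
  have hκ4 : (8 : ℝ≥0) / 3 ≤ 4 := by
    rw [div_le_iff₀ (by norm_num : (0 : ℝ≥0) < 3)]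
    norm_num
  haveI hP : IsProbabilityMeasure Literature.Probability.Process.preWienerMeasure := isProbabilityMeasure_preWienerMeasure'
  have hext : JordanDomain.continuousOn_boundaryExtension :=
    JordanDomain.continuousOn_boundaryExtension_of_disc hC
  have h₈ : JordanDomain.mapsTo_boundaryExtension := JordanDomain.mapsTo_boundaryExtension_of_disc hC
  have h₉ : CurveClass.measurableSet_simple (E := ℂ) := CurveClass.measurableSet_simple_holds
  obtain ⟨Γ, hΓm, hΓae⟩ := exists_isSLECurve_through_of_ae_tendsto hκt htr hext (hmeas hκt) hφ
  have hsle : IsSLELaw ((8 : ℝ≥0) / 3) D (Literature.Probability.Process.preWienerMeasure.map Γ) :=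
    (IsSLECurve.of_through hφ hΓm hΓae).isSLELaw_map
  haveI : IsProbabilityMeasure (Literature.Probability.Process.preWienerMeasure.map Γ) :=
    Measure.isProbabilityMeasure_map hΓm
  refine ⟨_, hsle, inferInstance, ?_, fun A Φ d hA hΦ hd => ?_⟩
  · filter_upwards [hsle.ae_simple h₆ h₉ hκ0 hκ4, hsle.ae_endpoints h₈] with c h1 h2
    exact ⟨⟨⟨h1.1, h2.1⟩, h2.2.1⟩, subset_carrier_union_of_inter_frontier h2.2.2 h1.2⟩
  · have hclosed : IsClosed (φ.boundaryExtension '' A) :=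
      (MarkedDomain.isCompact_image_boundaryExtension hC hA.1.subset_closure hA.1.isCompact).isClosed
    have hm : MeasurableSet (CurveClass.rangeSubset (φ.boundaryExtension '' A)ᶜ) :=
      CurveClass.measurableSet_rangeSubset_compl hclosed
    rw [Measure.map_apply_of_aemeasurable hΓm hm, ← h61 hA hΦ hd]
    refine measure_congr (eventuallyEq_set.2 ?_)
    filter_upwards [hΓae, h₆ hκ0 hκ4] with ω ⟨_, c, hΓω, hc⟩ hsimple
    rw [mem_preimage, hΓω]
    exact hc.mk_mem_rangeSubset_compl_image_iff hφ (sleTrace_zero _ ω) hsimple.2 hC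
      hA.1.subset_closure hA.2

/-- **Registered sub-goal `stub_restrictionIdentifies_sleLaw`** (crux item
stmt-CriticalPhenomena-10472, line `floor-ratio-restriction-bootstrap`, stub
`stub_restrictionIdentifies`): registered one-line form of `exists_sleLaw_through` — through every
chordal uniformizing map `φ` of a Dobrushin domain `D` there is a chordal SLE(8/3) law of `D`, a
probability law carried by the chordal carrier whose probability of avoiding `φ̂(A)` is
`Φ'_A(0)^{5/8}` for every `*`-hull `A`. [cite: LawlerSchrammWerner2003Restriction, Thm. 6.1 (p. 23)] -/
theorem stub_restrictionIdentifies_sleLaw :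
    ∀ (D : DobrushinDomain) (φ : ConformalEquiv upperHalfPlaneSet D.carrier),
    D.IsChordalUniformizing φ →
    ∃ ν : Measure (CurveClass ℂ), IsSLELaw ((8 : ℝ≥0) / 3) D ν ∧ IsProbabilityMeasure ν ∧
      (∀ᵐ c ∂ν, c ∈ chordalCarrier D) ∧
      ∀ (A : Set ℂ) (Φ : ConformalEquiv (upperHalfPlaneSet \ A) upperHalfPlaneSet) (d : ℝ),
        IsStarHull A → IsRestrictionMap A Φ → HasRestrictionDeriv A Φ d →
        ν (CurveClass.rangeSubset (φ.boundaryExtension '' A)ᶜ) = ENNReal.ofReal (d ^ ((5 : ℝ) / 8)) :=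
  fun _ _ hφ => exists_sleLaw_through hφ

/-! ### Identification of the avoidance probability of a squeezed hull -/

/-- **The avoidance probability of a squeezed `*`-hull is identified.**  Let `μ` satisfy the
hypotheses of `stub_restrictionIdentifies` (probability subsequential limit law of the SAW curves,
carried by the chordal carrier, lattice hull-avoidance probabilities tending to `Φ'(0)^{5/8}` over
Jordan hull subdomains), let `ν` be a law carried by the chordal carrier with
`ν{trace ∩ φ̂(A) = ∅} = Φ'_A(0)^{5/8}` for all `*`-hulls `A` (the SLE(8/3) law), and let the
`*`-hull `B` be squeezed by the pull-backs `A_k ↓` of Jordan hull subdomains `D_k` with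
`B ∩ ℍ ⊆ int A_k`, `(⋂ A_k) ∩ ℍ ⊆ B`.  Then `μ{trace ∩ φ̂(B) = ∅} = ν{trace ∩ φ̂(B) = ∅}`: both are
`supₖ` of the avoidance probabilities of the `A_k` (`measure_avoid_eq_iSup_of_squeeze`), which
are `d_k^{5/8}` for `ν`, and squeezed between `d_k^{5/8}` and `μ{trace ∩ φ̂(B) = ∅}` for `μ` by the
portmanteau sandwich. [cite: LawlerSchrammWerner2003Restriction, Thm. 6.1 (p. 23) and Lemma 3.2 (p. 10), transposed] -/
theorem measure_avoid_eq_of_squeeze {D : DobrushinDomain} {a b : ℝ → HexVertex}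
    {μ : Measure (CurveClass ℂ)} (hab : IsEmbEndpointApprox hexGraph hexCenter D a b)
    [IsProbabilityMeasure μ]
    (hμ : IsSubseqLimitLaw (fun δ (γ : HexDomainSAW D.carrier δ (a δ) (b δ)) => γ.curve)
      (fun δ => hexSAWLaw D.carrier δ (a δ) (b δ)) μ)
    (hcar : ∀ᵐ c ∂μ, c ∈ chordalCarrier D)
    (hlat : ∀ (D' : DobrushinDomain) (φ : ConformalEquiv upperHalfPlaneSet D.carrier)
      (Φ : ConformalEquiv (upperHalfPlaneSet \ φ.pullbackHull D') upperHalfPlaneSet) (d : ℝ),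
      D.IsHullSubdomain D' → D.IsChordalUniformizing φ →
      IsRestrictionMap (φ.pullbackHull D') Φ → HasRestrictionDeriv (φ.pullbackHull D') Φ d →
      Tendsto (fun δ : ℝ => ((hexSAWLaw D.carrier δ (a δ) (b δ))
        {γ | (∀ v ∈ γ.walk.support, v ∈ embMeshVertices hexCenter D'.carrier δ) ∧
          ∀ e ∈ γ.walk.darts,
            (embMeshGraph hexGraph hexCenter D'.carrier δ).Adj e.fst e.snd}).toReal)
        (𝓝[>] 0) (𝓝 (d ^ ((5 : ℝ) / 8))))
    {φ : ConformalEquiv upperHalfPlaneSet D.carrier} (hφ : D.IsChordalUniformizing φ)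
    {ν : Measure (CurveClass ℂ)} (hνcar : ∀ᵐ c ∂ν, c ∈ chordalCarrier D)
    (hνav : ∀ (A : Set ℂ) (Φ : ConformalEquiv (upperHalfPlaneSet \ A) upperHalfPlaneSet) (d : ℝ),
      IsStarHull A → IsRestrictionMap A Φ → HasRestrictionDeriv A Φ d →
      ν (CurveClass.rangeSubset (φ.boundaryExtension '' A)ᶜ) = ENNReal.ofReal (d ^ ((5 : ℝ) / 8)))
    {B : Set ℂ} (hB : IsStarHull B) {Dk : ℕ → DobrushinDomain}
    (hDk : ∀ k, D.IsHullSubdomain (Dk k)) (hanti : Antitone fun k => φ.pullbackHull (Dk k))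
    (hint : ∀ k, B ∩ upperHalfPlaneSet ⊆ interior (φ.pullbackHull (Dk k)))
    (hlim : (⋂ k, φ.pullbackHull (Dk k)) ∩ upperHalfPlaneSet ⊆ B) :
    μ (CurveClass.rangeSubset (φ.boundaryExtension '' B)ᶜ) =
      ν (CurveClass.rangeSubset (φ.boundaryExtension '' B)ᶜ) := by
  classical
  have hsc : ∀ D : JordanDomain, D.isSimplyConnected := JordanDomain.isSimplyConnected_holds
  have hC : JordanDomain.exists_continuousOn_extension := JordanDomain.exists_continuousOn_extension_holds
  have hJarc : Literature.Topology.PlaneTopology.JordanArcSeparation :=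
    Literature.Topology.PlaneTopology.JordanArcSeparation_holds
  have hexΦ : IsStarHull.existsUnique_isRestrictionMap := IsStarHull.existsUnique_isRestrictionMap_holds
  have hex : IsStarHull.exists_hasRestrictionDeriv := IsStarHull.exists_hasRestrictionDeriv_holds
  -- the squeezing hulls, their restriction maps and derivatives
  set A : ℕ → Set ℂ := fun k => φ.pullbackHull (Dk k) with hAdef
  have hA : ∀ k, IsStarHull (A k) := fun k => IsStarHull.pullbackHull hsc hφ (hDk k)
  choose Φk hΦk _ using fun k => hexΦ (hA k)
  choose dk _ _ hdk using fun k => hex (hA k) (hΦk k)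
  have hsub : ∀ k, B ∩ upperHalfPlaneSet ⊆ A k := fun k => (hint k).trans interior_subset
  -- avoidance probabilities of `B` are suprema of those of the `A k`, for every carried law
  have hsup : ∀ (ρ : Measure (CurveClass ℂ)), (∀ᵐ c ∂ρ, c ∈ chordalCarrier D) →
      ρ (CurveClass.rangeSubset (φ.boundaryExtension '' B)ᶜ) =
        ⨆ k, ρ (CurveClass.rangeSubset (φ.boundaryExtension '' A k)ᶜ) := by
    intro ρ hρ
    rw [← ChordalFamily.pullbackLaw_avoid (hJarc := hJarc) (hC := hC) (hφ := hφ) (fun _ => ρ) hρ hB,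
      measure_avoid_eq_iSup_of_squeeze _ hanti (fun k => (hA k).1.isClosed) (hA 0).1.isCompact
        (hA 0).2 hsub hlim]
    exact iSup_congr fun k =>
      ChordalFamily.pullbackLaw_avoid (hJarc := hJarc) (hC := hC) (hφ := hφ) (fun _ => ρ) hρ (hA k)
  -- the lattice limits, as limits in `ℝ≥0∞`
  have hp : ∀ k, Tendsto (fun δ : ℝ => (hexSAWLaw D.carrier δ (a δ) (b δ))
      {γ | (∀ v ∈ γ.walk.support, v ∈ embMeshVertices hexCenter (Dk k).carrier δ) ∧
        ∀ e ∈ γ.walk.darts, (embMeshGraph hexGraph hexCenter (Dk k).carrier δ).Adj e.fst e.snd})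
      (𝓝[>] 0) (𝓝 (ENNReal.ofReal (dk k ^ ((5 : ℝ) / 8)))) := fun k => by
    have h1 := ENNReal.tendsto_ofReal (hlat (Dk k) φ (Φk k) (dk k) (hDk k) hφ (hΦk k) (hdk k))
    refine h1.congr' ?_
    filter_upwards [eventually_isProbabilityMeasure_hexSAWLaw hab] with δ hδ
    haveI := hδ
    exact ENNReal.ofReal_toReal (measure_ne_top _ _)
  -- `μ`: sandwich for each `k`
  have hup : ∀ k, μ (CurveClass.rangeSubset (φ.boundaryExtension '' A k)ᶜ) ≤
      ENNReal.ofReal (dk k ^ ((5 : ℝ) / 8)) ∧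
      ENNReal.ofReal (dk k ^ ((5 : ℝ) / 8)) ≤ μ (CurveClass.rangeSubset (closure (Dk k).carrier)) :=
    fun k => sandwich hab hμ (isClosed_image_pullbackHull hsc hC hφ (hDk k))
      diff_subset_image_pullbackHull
      (closure_diff_subset (isClosed_image_pullbackHull hsc hC hφ (hDk k))
        diff_subset_image_pullbackHull) (hp k)
  have hlow : ∀ k, μ (CurveClass.rangeSubset (closure (Dk k).carrier)) ≤
      μ (CurveClass.rangeSubset (φ.boundaryExtension '' B)ᶜ) := fun k => by
    refine measure_mono_ae ?_
    filter_upwards [hcar] with c hc hV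
    exact (disjoint_pullbackTrace_iff_mem_rangeSubset hC hφ hc hB.1.subset_closure hB.2).1
      (disjoint_pullbackTrace_of_rangeSubset_closure (hDk k) (hint k) hV)
  have hμeq : μ (CurveClass.rangeSubset (φ.boundaryExtension '' B)ᶜ) =
      ⨆ k, ENNReal.ofReal (dk k ^ ((5 : ℝ) / 8)) := by
    refine le_antisymm ?_ (iSup_le fun k => (hup k).2.trans (hlow k))
    rw [hsup μ hcar]
    exact iSup_mono fun k => (hup k).1
  -- `ν`: exact values
  have hνeq : ν (CurveClass.rangeSubset (φ.boundaryExtension '' B)ᶜ) =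
      ⨆ k, ENNReal.ofReal (dk k ^ ((5 : ℝ) / 8)) := by
    rw [hsup ν hνcar]
    exact iSup_congr fun k => hνav (A k) (Φk k) (dk k) (hA k) (hΦk k) (hdk k)
  rw [hμeq, hνeq]

end Summit.CriticalPhenomena.SAWScalingLimit.Theorems.ObservableToSLE.FloorRatio

end
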